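import Summits.AtomisticToContinuum.FouriersLaw.Theses.LocalOhmBV
import Summits.AtomisticToContinuum.FouriersLaw.Theorems.LocalOhmBVLocalOhmGlue
import Literature.Barriers.AtomisticToContinuum.HarmonicCrystalBallisticProofs
import Literature.Barriers.AtomisticToContinuum.FixedLengthNoConductivityControl

/-!
# Redirect strategist r1 — typed companion for crux `BVProfile` (stmt-AtomisticToContinuum-12012)

Verdict artefact of `cstrat-stmt-AtomisticToContinuum-12012-r1` (planner). No `sorry`, no new facts.

* §1 `BVProfileAt` — the crux conclusion as a predicate of an arbitrary `OscillatorChain`; the crux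
  `BVProfile` is literally its `lam, β > 0` section over `pinnedChain` (`bvProfile_iff`, by `Iff.rfl`).
  The SEPARATING WITNESS of the census lives at the harmonic corner `lam = β = 0` of the same family:
  there `FouriersLawFor` is refuted in the tree (`not_fouriersLawFor_harmonic`, re-exported in §3),
  while `BVProfileAt (pinnedChain ω₂ 0 0 γ)` is the Rieder–Lebowitz–Lieb boundary-layer profile
  statement (RLL 1967 eq. (4.2); exact Lyapunov numerics j023848: θ_N monotone, TV < 1) — recorded
  here as the named Prop `HarmonicCornerRung` (plan-only rung; not proved in this file).
* §2 REACH — the crux's only typed road towards the summit: with `LocalOhm` it gives `BoundedResponse`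
  (landed glue `localOhmGlue_proof`), and `BoundedResponse` is a NECESSARY condition of `FouriersLaw`
  (`boundedResponse_of_fouriersLaw`), never a sufficient one without the residual
  `BoundedResponseConverges` (crux 9141, `FouriersLaw ↔ BoundedResponse ∧ BoundedResponseConverges`).
-/

namespace Summit.AtomisticToContinuum.FouriersLaw.Cruxes.BVProfile.RedirectR1

open MeasureTheory Filter Topology
open Literature.MathematicalPhysics.KineticTheory.HeatConduction
open Summit.AtomisticToContinuum.FouriersLaw.Theses.LocalOhmBV

/-! ## §1 The crux as the `lam, β > 0` section of a chain predicate -/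

/-- The conclusion of crux `BVProfile`, for an arbitrary oscillator chain `P`: under weak-NESS
uniqueness, along any steady-state family and at any `T > 0`, the kinetic response profiles `θ_N`
have total variation bounded uniformly in `N`. -/
def BVProfileAt (P : OscillatorChain) : Prop :=
  (∀ (N : ℕ) (T_L T_R : ℝ), 0 < T_L → 0 < T_R → ∀ μ ν : Measure (PhaseSpace N),
      P.IsSteadyState N T_L T_R μ → P.IsSteadyState N T_L T_R ν → μ = ν) →
  ∀ μ : (N : ℕ) → ℝ → ℝ → Measure (PhaseSpace N),
    (∀ (N : ℕ) (T_L T_R : ℝ), 0 < T_L → 0 < T_R → P.IsSteadyState N T_L T_R (μ N T_L T_R)) →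
    ∀ T : ℝ, 0 < T → ∃ C : ℝ, ∀ (N : ℕ) (θ : Fin N → ℝ),
      (∀ i : Fin N, Tendsto (fun δ : ℝ =>
        ((∫ x, (x.2 i) ^ 2 ∂(μ N (T + δ / 2) (T - δ / 2))) - ∫ x, (x.2 i) ^ 2 ∂(μ N T T)) / δ)
        (𝓝[≠] 0) (𝓝 (θ i))) →
      ∑ i : Fin N, ∑ j : Fin N, (if j.val = i.val + 1 then |θ j - θ i| else 0) ≤ C

/-- The crux is *literally* the open-parameter section of `BVProfileAt`. -/
theorem bvProfile_iff :
    BVProfile ↔ ∀ ω₂ lam β γ : ℝ, 0 < ω₂ → 0 < lam → 0 < β → 0 < γ →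
      BVProfileAt (pinnedChain ω₂ lam β γ) :=
  Iff.rfl

/-- PLAN-ONLY RUNG (separating witness, not proved here): the harmonic-corner analogue of the crux.
Rieder–Lebowitz–Lieb 1967, eq. (4.2): the kinetic temperature profile of `pinnedChain ω₂ 0 0 γ`
deviates from the mean bath temperature only inside boundary layers of `N`-independent width, so
the response profile has `N`-uniformly bounded variation (exact Lyapunov numerics j023848: `θ_N`
monotone, `TV(θ_N) = 1 - 2g/γ < 1`, saturated by `N ≈ 16`). At this corner `FouriersLawFor` FAILS
(`harmonic_corner_refutes_summit_analogue` below). [cite: RiederLebowitzLieb1967, eq. (4.2)] -/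
def HarmonicCornerRung : Prop :=
  ∀ ω₂ γ : ℝ, 0 < ω₂ → 0 < γ → BVProfileAt (pinnedChain ω₂ 0 0 γ)

/-! ## §2 Reach of the crux inside the tree -/

/-- With `LocalOhm`, the crux yields exactly `BoundedResponse` (landed glue item 12072). -/
theorem boundedResponse_of_localOhm_of_bvProfile (hLO : LocalOhm) (hBV : BVProfile) :
    BoundedResponse :=
  Summit.AtomisticToContinuum.FouriersLaw.Theorems.localOhmGlue_proof
    FiniteResponseProfile_holds hLO hBV

/-- `BoundedResponse` is a NECESSARY condition of the sub-problem statement (BLR 2000 §6.3): the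
waypoint the crux reaches is implied by `FouriersLaw`, so reaching it decides nothing by itself. -/
theorem boundedResponse_of_fouriersLaw (h : _root_.FouriersLaw) : BoundedResponse := by
  intro ω₂ lam β γ hω hl hβ hγ _hU μ hμ T hT D hD
  exact Literature.Barriers.AtomisticToContinuum.hasBoundedResponse_of_fouriersLawFor
    (h ω₂ lam β γ hω hl hβ hγ) μ hμ T hT D hD

/-! ## §3 The summit analogue fails at the separating corner -/

/-- At the harmonic corner the analogue of the SUMMIT is false (tree theorem, BLR 2000 §6.2/§7),
while the analogue of the CRUX is `HarmonicCornerRung` (RLL 1967 (4.2)). -/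
theorem harmonic_corner_refutes_summit_analogue {ω₂ γ : ℝ} (hω : 0 < ω₂) (hγ : 0 < γ) :
    ¬ (pinnedChain ω₂ 0 0 γ).FouriersLawFor :=
  Literature.Barriers.AtomisticToContinuum.not_fouriersLawFor_harmonic hω hγ

end Summit.AtomisticToContinuum.FouriersLaw.Cruxes.BVProfile.RedirectR1
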